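import Mathlib.Analysis.SpecialFunctions.Pow.Real
import Mathlib.Analysis.Complex.ExponentialBounds
import Mathlib.Data.Nat.Choose.Bounds
import Mathlib.Algebra.Order.Field.GeomSum
import Literature.Computability.Complexity.CliqueCounting
import Literature.Computability.MetaComplexity.ScopeExpansion
import HarnessLib

/-!
# The first-moment estimate behind the KMOW random-graph theorem for `k`-SAT

Trunk Literature/Computability/MetaComplexity. Support file for the discharge of the named fact
`kmow_random_kCNF_plausible` (`ScopeExpansion.lean`; Kothari–Mori–O'Donnell–Witmer 2017,
Thm. 4.12, proof in their Appendix A): the purely real-analytic part of the union bound.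

For a random `k`-CNF with `m = Δ n` clauses, the expected number of families of `c` clause
positions whose scopes all lie in a fixed-size set of `t` variables is at most
`C(m, c) · C(n, t) · (C(t, k)/C(n, k))^c`. With `t < (k + ζ) c / 2` (a failure of cover
expansion `(k + ζ)/2`), `c ≤ 2·SMALL` and `SMALL ≤ γ n / Δ^{2/(k-2-ζ)}`,
`γ = kmowGamma 2000 k β = (1/k)(β^{1/(k-2)}/2^{k/(k-2)})^{2000}`, this is at most `(β/4)^c`
(`kmow_term_le`), and `Σ_{c ≥ 1} (β/4)^c ≤ β` (`sum_Ico_pow_div_four_le`). The universal exponent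
`2000` is one admissible value of the paper's `O(1)`.

* `choose_le_exp_mul_div_pow'` : `C(m,c) ≤ (e m / c)^c` (private copy);
  `choose_div_choose_le_div_pow : C(t,k)/C(n,k) ≤ (t/n)^k` (`t ≤ n`, from the tree's
  `choose_mul_pow_le_choose_mul_pow`, `CliqueCounting.lean`); `term_le_closed_form` — combined:
  `C(m,c) C(n,t) (C(t,k)/C(n,k))^c ≤ (e m/c)^c e^t (t/n)^{kc-t}`;
* `kmow_b_le_half`, `kmow_b_rpow_lambda` — the base `b = β^{1/λ}/2^{k/λ}` (`λ = k-2`) lies in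
  `(0, 1/2]` and `b^λ = β/2^k`; `kmow_small_le : 2 k · SMALL ≤ n`;
* `kmow_base_le : e^{k+1} k Δ (kc/n)^{(λ-ζ)/2} ≤ β/4`; `kmow_term_le`; `sum_Ico_pow_div_four_le`.

## References

* P. K. Kothari, R. Mori, R. O'Donnell, D. Witmer, *Sum of squares lower bounds for refuting any
  CSP*, STOC 2017, arXiv:1701.04521, Thm. 4.12 and Appendix A (eqns. (cv-bound1)–(the-bound),
  (weirdness)).
-/

noncomputable section

open Finset Real Literature.Computability.Complexity

namespace Literature.Computability.MetaComplexity

/-! ### Binomial estimates -/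

/-- `C(m, c) ≤ (e·m/c)^c` for `c ≥ 1` (from `C(m,c) ≤ m^c/c!` and `c^c/c! ≤ e^c`). A private
copy of the lemma of the same name in `XorificationLiftProofs.lean` (not imported here to keep this
file's imports light). [Kothari–Mori–O'Donnell–Witmer 2017, Appendix A (`C(m,c) ≤ (em/c)^c`)]
[folklore] -/
private theorem choose_le_exp_mul_div_pow' (m c : ℕ) (hc : 1 ≤ c) :
    (m.choose c : ℝ) ≤ (exp 1 * m / c) ^ c := by
  have h1 : (m.choose c : ℝ) ≤ (m : ℝ) ^ c / c.factorial := Nat.choose_le_pow_div c m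
  have h2 : (c : ℝ) ^ c / c.factorial ≤ exp c := pow_div_factorial_le_exp (c : ℝ) (Nat.cast_nonneg c) c
  have hc0 : (0 : ℝ) < c := by exact_mod_cast hc
  have hfac : (0 : ℝ) < c.factorial := by exact_mod_cast c.factorial_pos
  calc (m.choose c : ℝ) ≤ (m : ℝ) ^ c / c.factorial := h1
    _ = (m / c : ℝ) ^ c * ((c : ℝ) ^ c / c.factorial) := by
        rw [div_pow]
        field_simp
    _ ≤ (m / c : ℝ) ^ c * exp c := by gcongr
    _ = (exp 1 * m / c) ^ c := by
        rw [← exp_one_pow, mul_div_assoc, mul_pow, mul_comm]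

/-- `C(t,k)/C(n,k) ≤ (t/n)^k` for `t ≤ n`, `0 < n` (a uniform `k`-subset of `[n]` lies inside a
fixed `t`-set with probability at most `(t/n)^k`). [Kothari–Mori–O'Donnell–Witmer 2017,
Appendix A] [folklore] -/
theorem choose_div_choose_le_div_pow {t n : ℕ} (htn : t ≤ n) (hn : 0 < n) (k : ℕ) :
    (t.choose k : ℝ) / n.choose k ≤ ((t : ℝ) / n) ^ k := by
  rcases Nat.eq_zero_or_pos (n.choose k) with h | h
  · rw [h, Nat.cast_zero, div_zero]
    positivity
  · rw [div_le_iff₀ (by exact_mod_cast h), div_pow, div_mul_eq_mul_div, le_div_iff₀ (by positivity)]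
    have h' := Literature.Computability.Complexity.choose_mul_pow_le_choose_mul_pow htn k
    rw [mul_comm (n.choose k)] at h'
    exact_mod_cast h'

/-- The three binomial estimates combined:
`C(m,c) C(n,t) (C(t,k)/C(n,k))^c ≤ (e m/c)^c · e^t · (t/n)^{kc-t}` (`1 ≤ c`, `1 ≤ t ≤ n`,
`t ≤ kc`). [Kothari–Mori–O'Donnell–Witmer 2017, Appendix A, (cv-bound2)–(the-bound)] [folklore] -/
theorem term_le_closed_form {k c t n m : ℕ} (hc : 1 ≤ c) (ht : 1 ≤ t) (htn : t ≤ n)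
    (htk : t ≤ k * c) :
    (m.choose c : ℝ) * n.choose t * ((t.choose k : ℝ) / n.choose k) ^ c ≤
      (exp 1 * m / c) ^ c * exp 1 ^ t * ((t : ℝ) / n) ^ (k * c - t) := by
  have hn : 0 < n := lt_of_lt_of_le ht htn
  have hn' : (0 : ℝ) < n := by exact_mod_cast hn
  have ht' : (0 : ℝ) < t := by exact_mod_cast ht
  have h1 := choose_le_exp_mul_div_pow' m c hc
  have h2 := choose_le_exp_mul_div_pow' n t ht
  have h3 : ((t.choose k : ℝ) / n.choose k) ^ c ≤ (((t : ℝ) / n) ^ k) ^ c :=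
    pow_le_pow_left₀ (by positivity) (choose_div_choose_le_div_pow htn hn k) c
  have h4a : ((t : ℝ) / n) ^ (k * c) = ((t : ℝ) / n) ^ t * ((t : ℝ) / n) ^ (k * c - t) := by
    rw [← pow_add, Nat.add_sub_cancel' htk]
  have h4b : (exp 1 * n / t) ^ t * ((t : ℝ) / n) ^ t = exp 1 ^ t := by
    rw [← mul_pow]
    congr 1
    field_simp
  have h4 : (exp 1 * n / t) ^ t * (((t : ℝ) / n) ^ k) ^ c =
      exp 1 ^ t * ((t : ℝ) / n) ^ (k * c - t) := by
    rw [← pow_mul, h4a, ← mul_assoc, h4b]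
  calc (m.choose c : ℝ) * n.choose t * ((t.choose k : ℝ) / n.choose k) ^ c
      ≤ (exp 1 * m / c) ^ c * (exp 1 * n / t) ^ t * (((t : ℝ) / n) ^ k) ^ c :=
        mul_le_mul (mul_le_mul h1 h2 (by positivity) (by positivity)) h3 (by positivity)
          (by positivity)
    _ = (exp 1 * m / c) ^ c * exp 1 ^ t * ((t : ℝ) / n) ^ (k * c - t) := by
        rw [mul_assoc, h4, mul_assoc]

/-- A numerical inequality: `4 · 3^{k+1} · 4^k ≤ 1024^k` for `k ≥ 1`. [folklore] -/
theorem four_mul_three_pow_succ_mul_le (k : ℕ) (hk : 1 ≤ k) :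
    4 * 3 ^ (k + 1) * 2 ^ k * 2 ^ k ≤ 1024 ^ k := by
  have h1 : 3 ^ (k + 1) ≤ 4 ^ (k + 1) := Nat.pow_le_pow_left (by norm_num) _
  have h2 : 16 ≤ 64 ^ k := le_trans (by norm_num) (Nat.le_self_pow (by omega) 64)
  calc 4 * 3 ^ (k + 1) * 2 ^ k * 2 ^ k ≤ 4 * 4 ^ (k + 1) * 2 ^ k * 2 ^ k := by gcongr
    _ = 16 * (4 * 2 * 2) ^ k := by rw [mul_pow, mul_pow, pow_succ]; ring
    _ = 16 * 16 ^ k := by norm_num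
    _ ≤ 64 ^ k * 16 ^ k := Nat.mul_le_mul_right _ h2
    _ = 1024 ^ k := by rw [← mul_pow]; norm_num

/-! ### The constant `γ` -/

/-- The base `b = β^{1/(k-2)} / 2^{k/(k-2)}` of `kmowGamma` is at most `1/2` (`k ≥ 3`,
`0 ≤ β ≤ 1`). [Kothari–Mori–O'Donnell–Witmer 2017, Thm. 4.12 (`γ`)] [folklore] -/
theorem kmow_b_le_half {k : ℕ} (hk : 3 ≤ k) {β : ℝ} (hβ : 0 ≤ β) (hβ1 : β ≤ 1) :
    β ^ (1 / ((k : ℝ) - 2)) / 2 ^ ((k : ℝ) / ((k : ℝ) - 2)) ≤ 1 / 2 := by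
  have hk3 : (3 : ℝ) ≤ k := by exact_mod_cast hk
  have hl : 0 < (k : ℝ) - 2 := by linarith
  have h1 : β ^ (1 / ((k : ℝ) - 2)) ≤ 1 := rpow_le_one hβ hβ1 (by positivity)
  have h2 : (2 : ℝ) ≤ 2 ^ ((k : ℝ) / ((k : ℝ) - 2)) := by
    calc (2 : ℝ) = 2 ^ (1 : ℝ) := (rpow_one 2).symm
      _ ≤ 2 ^ ((k : ℝ) / ((k : ℝ) - 2)) :=
          rpow_le_rpow_of_exponent_le (by norm_num) (by rw [le_div_iff₀ hl]; linarith)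
  calc β ^ (1 / ((k : ℝ) - 2)) / 2 ^ ((k : ℝ) / ((k : ℝ) - 2))
      ≤ 1 / 2 ^ ((k : ℝ) / ((k : ℝ) - 2)) := by gcongr
    _ ≤ 1 / 2 := one_div_le_one_div_of_le (by norm_num) h2

/-- `b^{k-2} = β / 2^k` for the base `b` of `kmowGamma`. [Kothari–Mori–O'Donnell–Witmer 2017,
Thm. 4.12 (`γ`)] [folklore] -/
theorem kmow_b_rpow_lambda {k : ℕ} (hk : 3 ≤ k) {β : ℝ} (hβ : 0 ≤ β) :
    (β ^ (1 / ((k : ℝ) - 2)) / 2 ^ ((k : ℝ) / ((k : ℝ) - 2))) ^ ((k : ℝ) - 2) = β / 2 ^ k := by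
  have hk3 : (3 : ℝ) ≤ k := by exact_mod_cast hk
  have hl : (k : ℝ) - 2 ≠ 0 := (by linarith : (0 : ℝ) < k - 2).ne'
  rw [div_rpow (by positivity) (by positivity), ← rpow_mul hβ, ← rpow_mul (by norm_num),
    one_div_mul_cancel hl, rpow_one, div_mul_cancel₀ _ hl, rpow_natCast]

/-- **Smallness of `SMALL`.** Under the hypotheses of `kmow_random_kCNF_plausible` (with
`C₀ = 2000`) and `Δ ≥ 1`: `2 k · nₛ ≤ n`; in particular `(k + ζ) nₛ ≤ n`, so cover expansion
`(k+ζ)/2` of families of `≤ 2 nₛ` clauses is not excluded by counting.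
[Kothari–Mori–O'Donnell–Witmer 2017, Thm. 4.12] [folklore] -/
theorem kmow_small_le {k : ℕ} (hk : 3 ≤ k) {ζ β : ℝ} (hζ' : ζ ≤ 0.99 * ((k : ℝ) - 2))
    (hβ : 0 < β) (hβ' : β < 1 / 2) {Δ n nₛ : ℕ} (hΔ : 1 ≤ Δ)
    (hsm : (nₛ : ℝ) ≤ kmowGamma 2000 k β * n / (Δ : ℝ) ^ (2 / ((k : ℝ) - 2 - ζ))) :
    2 * (k : ℝ) * nₛ ≤ n := by
  have hk3 : (3 : ℝ) ≤ k := by exact_mod_cast hk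
  have hk0 : (0 : ℝ) < k := by linarith
  have hb := kmow_b_le_half hk hβ.le (by linarith)
  have hγpos : 0 < kmowGamma 2000 k β := kmowGamma_pos (by omega) hβ
  have hγ : kmowGamma 2000 k β ≤ 1 / (2 * k) := by
    have h1 : (β ^ (1 / ((k : ℝ) - 2)) / 2 ^ ((k : ℝ) / ((k : ℝ) - 2))) ^ (2000 : ℝ) ≤ 1 / 2 :=
      calc (β ^ (1 / ((k : ℝ) - 2)) / 2 ^ ((k : ℝ) / ((k : ℝ) - 2))) ^ (2000 : ℝ)
          ≤ (1 / 2 : ℝ) ^ (2000 : ℝ) := rpow_le_rpow (by positivity) hb (by norm_num)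
        _ ≤ (1 / 2 : ℝ) ^ (1 : ℝ) :=
            rpow_le_rpow_of_exponent_ge (by norm_num) (by norm_num) (by norm_num)
        _ = 1 / 2 := rpow_one _
    unfold kmowGamma
    calc 1 / (k : ℝ) * (β ^ (1 / ((k : ℝ) - 2)) / 2 ^ ((k : ℝ) / ((k : ℝ) - 2))) ^ (2000 : ℝ)
        ≤ 1 / (k : ℝ) * (1 / 2) := by gcongr
      _ = 1 / (2 * k) := by ring
  have hexp : (1 : ℝ) ≤ (Δ : ℝ) ^ (2 / ((k : ℝ) - 2 - ζ)) :=
    one_le_rpow (by exact_mod_cast hΔ) (div_nonneg (by norm_num) (by linarith))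
  have h1 : (nₛ : ℝ) ≤ kmowGamma 2000 k β * n := hsm.trans (div_le_self (by positivity) hexp)
  calc 2 * (k : ℝ) * nₛ ≤ 2 * k * (kmowGamma 2000 k β * n) := by gcongr
    _ ≤ 2 * k * (1 / (2 * k) * n) := by gcongr
    _ = n := by field_simp

/-! ### The per-size bound -/

/-- **The base of the per-size bound.** With `μ = (k - 2 - ζ)/2`, `c ≤ 2·SMALL` and
`SMALL ≤ γ n / Δ^{1/μ}`: `e^{k+1} k Δ (kc/n)^μ ≤ β/4` — KMOW's (weirdness)
`20^K Δ (Kc/n)^{(λ-ζ)/2} ≤ β/50^K` for `k`-SAT with the explicit exponent `2000`.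
[Kothari–Mori–O'Donnell–Witmer 2017, Appendix A, (weirdness)] [folklore] -/
theorem kmow_base_le {k : ℕ} (hk : 3 ≤ k) {ζ β : ℝ} (hζ : 0 < ζ) (hζ' : ζ ≤ 0.99 * ((k : ℝ) - 2))
    (hβ : 0 < β) (hβ' : β < 1 / 2) {Δ n c : ℕ} (hΔ : 1 ≤ Δ) (hn : 1 ≤ n)
    (hcs : (c : ℝ) ≤ 2 * (kmowGamma 2000 k β * n / (Δ : ℝ) ^ (2 / ((k : ℝ) - 2 - ζ)))) :
    exp 1 ^ (k + 1) * k * Δ * ((k : ℝ) * c / n) ^ (((k : ℝ) - 2 - ζ) / 2) ≤ β / 4 := by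
  have hk3 : (3 : ℝ) ≤ k := by exact_mod_cast hk
  have hk0 : (0 : ℝ) < k := by linarith
  have hk0' : (k : ℝ) ≠ 0 := hk0.ne'
  have hk1 : 1 ≤ k := by omega
  have hn' : (0 : ℝ) < n := by exact_mod_cast hn
  have hΔ' : (0 : ℝ) < Δ := by exact_mod_cast hΔ
  set l := (k : ℝ) - 2 with hl
  set μ := (l - ζ) / 2 with hμ
  set γ := kmowGamma 2000 k β with hγ
  set b := β ^ (1 / l) / 2 ^ ((k : ℝ) / l) with hb
  have hl1 : 1 ≤ l := by rw [hl]; linarith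
  have hμpos : 0 < μ := by rw [hμ]; linarith
  have hμle : μ ≤ (k : ℝ) := by rw [hμ]; linarith
  have hμge : l * ((10 : ℕ) : ℝ) ≤ 2000 * μ := by rw [hμ]; norm_num; linarith
  have hγpos : 0 < γ := kmowGamma_pos (by omega) hβ
  have hbpos : 0 < b := by positivity
  have hbh : b ≤ 1 / 2 := kmow_b_le_half hk hβ.le (by linarith)
  have hb1 : b ≤ 1 := by linarith
  -- (E1) `kc/n ≤ 2kγ / Δ^{1/μ}`
  have he : 2 / (l - ζ) = 1 / μ := by
    rw [hμ]
    field_simp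
  rw [he] at hcs
  have hkc : (k : ℝ) * c / n ≤ 2 * k * γ / (Δ : ℝ) ^ (1 / μ) := by
    rw [div_le_iff₀ hn']
    calc (k : ℝ) * c ≤ k * (2 * (γ * n / (Δ : ℝ) ^ (1 / μ))) :=
          mul_le_mul_of_nonneg_left hcs hk0.le
      _ = 2 * k * γ / (Δ : ℝ) ^ (1 / μ) * n := by ring
  -- (E2) `(kc/n)^μ ≤ (2kγ)^μ / Δ`
  have hpow : ((k : ℝ) * c / n) ^ μ ≤ (2 * k * γ) ^ μ / Δ :=
    calc ((k : ℝ) * c / n) ^ μ ≤ (2 * k * γ / (Δ : ℝ) ^ (1 / μ)) ^ μ :=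
          rpow_le_rpow (by positivity) hkc hμpos.le
      _ = (2 * k * γ) ^ μ / ((Δ : ℝ) ^ (1 / μ)) ^ μ := div_rpow (by positivity) (by positivity) μ
      _ = (2 * k * γ) ^ μ / Δ := by rw [one_div, rpow_inv_rpow hΔ'.le hμpos.ne']
  -- (E3) `2kγ = 2 b^2000`
  have h2kγ : 2 * k * γ = 2 * b ^ (2000 : ℝ) := by
    rw [hγ, kmowGamma, ← hl, ← hb]
    field_simp
  -- (E4) `(2 b^2000)^μ ≤ 2^k (β/2^k)^10`
  have hbμ : (2 * b ^ (2000 : ℝ)) ^ μ ≤ 2 ^ k * (β / 2 ^ k) ^ 10 := by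
    rw [mul_rpow (by norm_num) (by positivity)]
    have h5 : (2 : ℝ) ^ μ ≤ 2 ^ k :=
      calc (2 : ℝ) ^ μ ≤ (2 : ℝ) ^ (k : ℝ) := rpow_le_rpow_of_exponent_le (by norm_num) hμle
        _ = 2 ^ k := rpow_natCast 2 k
    have h6 : (b ^ (2000 : ℝ)) ^ μ ≤ (β / 2 ^ k) ^ 10 := by
      rw [← rpow_mul hbpos.le]
      calc b ^ ((2000 : ℝ) * μ) ≤ b ^ (l * ((10 : ℕ) : ℝ)) :=
            rpow_le_rpow_of_exponent_ge hbpos hb1 hμge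
        _ = (b ^ l) ^ 10 := rpow_mul_natCast hbpos.le _ _
        _ = (β / 2 ^ k) ^ 10 := by rw [hb, hl, kmow_b_rpow_lambda hk hβ.le]
    exact mul_le_mul h5 h6 (by positivity) (by positivity)
  -- (E5) numerics
  have hnum : exp 1 ^ (k + 1) * k * (2 ^ k * (β / 2 ^ k) ^ 10) ≤ β / 4 := by
    have he3 : exp 1 ≤ 3 := exp_one_lt_three.le
    have h7 : exp 1 ^ (k + 1) ≤ 3 ^ (k + 1) := pow_le_pow_left₀ (exp_pos 1).le he3 _
    have h8 : (k : ℝ) ≤ 2 ^ k := by exact_mod_cast (Nat.lt_two_pow_self (n := k)).le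
    have h9 : (4 * 3 ^ (k + 1) * 2 ^ k * 2 ^ k : ℝ) ≤ 1024 ^ k := by
      exact_mod_cast four_mul_three_pow_succ_mul_le k hk1
    have h10 : ((2 : ℝ) ^ k) ^ 10 = 1024 ^ k := by
      rw [← pow_mul, mul_comm, pow_mul]
      norm_num
    have hβ10 : β ^ 10 ≤ β := pow_le_of_le_one hβ.le (by linarith) (by norm_num)
    calc exp 1 ^ (k + 1) * k * (2 ^ k * (β / 2 ^ k) ^ 10)
        = exp 1 ^ (k + 1) * k * 2 ^ k * β ^ 10 / 1024 ^ k := by rw [div_pow, h10]; ring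
      _ ≤ 3 ^ (k + 1) * 2 ^ k * 2 ^ k * β ^ 10 / 1024 ^ k := by gcongr
      _ = (4 * 3 ^ (k + 1) * 2 ^ k * 2 ^ k) * β ^ 10 / (4 * 1024 ^ k) := by
          field_simp
      _ ≤ 1024 ^ k * β / (4 * 1024 ^ k) := by gcongr
      _ = β / 4 := by
          field_simp
  -- assembly
  calc exp 1 ^ (k + 1) * k * Δ * ((k : ℝ) * c / n) ^ μ
      ≤ exp 1 ^ (k + 1) * k * Δ * ((2 * k * γ) ^ μ / Δ) := by gcongr
    _ = exp 1 ^ (k + 1) * k * (2 * k * γ) ^ μ := by field_simp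
    _ = exp 1 ^ (k + 1) * k * (2 * b ^ (2000 : ℝ)) ^ μ := by rw [h2kγ]
    _ ≤ exp 1 ^ (k + 1) * k * (2 ^ k * (β / 2 ^ k) ^ 10) := by gcongr
    _ ≤ β / 4 := hnum

/-- **The per-size bound.** Under the hypotheses of `kmow_random_kCNF_plausible` with
`C₀ = 2000`, `Δ ≥ 1`, for a family size `1 ≤ c ≤ 2·SMALL` and the integer `t` with
`t < (k+ζ)c/2 ≤ t + 1`, `t ≤ n`: `C(Δn, c) · C(n, t) · (C(t,k)/C(n,k))^c ≤ (β/4)^c` — the expected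
number of `c`-families of clauses covering at most `t` variables.
[Kothari–Mori–O'Donnell–Witmer 2017, Appendix A ((cv-bound1) ≤ (β/50^K)^c)] [folklore] -/
theorem kmow_term_le {k : ℕ} (hk : 3 ≤ k) {ζ β : ℝ} (hζ : 0 < ζ) (hζ' : ζ ≤ 0.99 * ((k : ℝ) - 2))
    (hβ : 0 < β) (hβ' : β < 1 / 2) {Δ n c t : ℕ} (hΔ : 1 ≤ Δ) (hc : 1 ≤ c)
    (ht1 : (t : ℝ) < ((k : ℝ) + ζ) / 2 * c) (ht2 : ((k : ℝ) + ζ) / 2 * c ≤ t + 1) (htn : t ≤ n)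
    (hcs : (c : ℝ) ≤ 2 * (kmowGamma 2000 k β * n / (Δ : ℝ) ^ (2 / ((k : ℝ) - 2 - ζ)))) :
    ((Δ * n).choose c : ℝ) * n.choose t * ((t.choose k : ℝ) / n.choose k) ^ c ≤ (β / 4) ^ c := by
  have hk3 : (3 : ℝ) ≤ k := by exact_mod_cast hk
  have hc1 : (1 : ℝ) ≤ c := by exact_mod_cast hc
  have ht0 : 1 ≤ t := by
    have h : (0 : ℝ) < t := by nlinarith
    exact_mod_cast h
  have htk : t ≤ k * c := by
    have h : (t : ℝ) ≤ k * c := by nlinarith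
    exact_mod_cast h
  have hn : 1 ≤ n := ht0.trans htn
  have hn' : (0 : ℝ) < n := by exact_mod_cast hn
  have ht' : (0 : ℝ) < t := by exact_mod_cast ht0
  have htn' : (t : ℝ) ≤ n := by exact_mod_cast htn
  have htk' : (t : ℝ) ≤ k * c := by exact_mod_cast htk
  have hΔ' : (0 : ℝ) < Δ := by exact_mod_cast hΔ
  have hE := kmow_base_le hk hζ hζ' hβ hβ' hΔ hn hcs
  set μ := ((k : ℝ) - 2 - ζ) / 2 with hμ
  have hμpos : 0 < μ := by rw [hμ]; linarith
  -- Step A: closed form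
  have hA := term_le_closed_form (m := Δ * n) (k := k) hc ht0 htn htk
  -- Step B: real exponent
  have hx0 : (0 : ℝ) < t / n := by positivity
  have hx1 : (t : ℝ) / n ≤ 1 := by rwa [div_le_one hn']
  have hB : ((t : ℝ) / n) ^ (k * c - t) ≤ ((t : ℝ) / n) ^ c * ((t : ℝ) / n) ^ (μ * c) := by
    have hcast : (((k * c - t : ℕ) : ℝ)) = (k : ℝ) * c - t := by
      rw [Nat.cast_sub htk, Nat.cast_mul]
    have hexp : (c : ℝ) + μ * c ≤ (k : ℝ) * c - t := by
      rw [hμ]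
      linarith
    calc ((t : ℝ) / n) ^ (k * c - t) = ((t : ℝ) / n) ^ ((k * c - t : ℕ) : ℝ) :=
          (rpow_natCast _ _).symm
      _ ≤ ((t : ℝ) / n) ^ ((c : ℝ) + μ * c) :=
          rpow_le_rpow_of_exponent_ge hx0 hx1 (by rw [hcast]; exact hexp)
      _ = ((t : ℝ) / n) ^ (c : ℝ) * ((t : ℝ) / n) ^ (μ * c) := rpow_add hx0 _ _
      _ = ((t : ℝ) / n) ^ c * ((t : ℝ) / n) ^ (μ * c) := by rw [rpow_natCast]
  -- Steps C, D
  have hC1 : (exp 1 * ((Δ * n : ℕ) : ℝ) / c) ^ c * ((t : ℝ) / n) ^ c ≤ (exp 1 * Δ * k) ^ c := by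
    rw [← mul_pow]
    apply pow_le_pow_left₀ (by positivity)
    rw [Nat.cast_mul]
    have h1 : exp 1 * ((Δ : ℝ) * n) / c * (t / n) = exp 1 * Δ * (t / c) := by
      field_simp
    rw [h1]
    have htc : (t : ℝ) / c ≤ k := by
      rw [div_le_iff₀ (by positivity)]
      exact htk'
    gcongr
  have hC2 : exp 1 ^ t ≤ (exp 1 ^ k) ^ c := by
    rw [← pow_mul]
    exact pow_le_pow_right₀ (by linarith [add_one_le_exp (1 : ℝ)]) htk
  have hD : ((t : ℝ) / n) ^ (μ * c) ≤ ((((k : ℝ) * c) / n) ^ μ) ^ c := by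
    rw [← rpow_mul_natCast (by positivity)]
    exact rpow_le_rpow hx0.le (by gcongr) (by positivity)
  -- assembly
  calc ((Δ * n).choose c : ℝ) * n.choose t * ((t.choose k : ℝ) / n.choose k) ^ c
      ≤ (exp 1 * ((Δ * n : ℕ) : ℝ) / c) ^ c * exp 1 ^ t * ((t : ℝ) / n) ^ (k * c - t) := hA
    _ ≤ (exp 1 * ((Δ * n : ℕ) : ℝ) / c) ^ c * exp 1 ^ t *
          (((t : ℝ) / n) ^ c * ((t : ℝ) / n) ^ (μ * c)) := by gcongr
    _ = ((exp 1 * ((Δ * n : ℕ) : ℝ) / c) ^ c * ((t : ℝ) / n) ^ c) * exp 1 ^ t *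
          ((t : ℝ) / n) ^ (μ * c) := by ring
    _ ≤ (exp 1 * Δ * k) ^ c * (exp 1 ^ k) ^ c * ((((k : ℝ) * c) / n) ^ μ) ^ c :=
        mul_le_mul (mul_le_mul hC1 hC2 (by positivity) (by positivity)) hD (by positivity)
          (by positivity)
    _ = (exp 1 ^ (k + 1) * k * Δ * (((k : ℝ) * c) / n) ^ μ) ^ c := by
        rw [← mul_pow, ← mul_pow]
        ring
    _ ≤ (β / 4) ^ c := pow_le_pow_left₀ (by positivity) hE c

/-! ### Summing over the sizes -/

/-- `Σ_{c=1}^{N} (β/4)^c ≤ β` for `0 ≤ β ≤ 2`. [Kothari–Mori–O'Donnell–Witmer 2017, Appendix A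
("summing over all `c ≥ 1` we get `≤ β`")] [folklore] -/
theorem sum_Ico_pow_div_four_le {β : ℝ} (hβ : 0 ≤ β) (hβ' : β ≤ 2) (N : ℕ) :
    ∑ c ∈ Finset.Ico 1 (N + 1), (β / 4) ^ c ≤ β := by
  have h1 : ∑ c ∈ Finset.Ico 1 (N + 1), (β / 4) ^ c ≤ (β / 4) ^ 1 / (1 - β / 4) :=
    geom_sum_Ico_le_of_lt_one (by positivity) (by linarith)
  rw [pow_one] at h1
  refine h1.trans ?_
  rw [div_le_iff₀ (by linarith)]
  nlinarith

end Literature.Computability.MetaComplexity
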